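import Mathlib.MeasureTheory.Integral.IntervalIntegral.FundThmCalculus
import Mathlib.MeasureTheory.Integral.IntegralEqImproper
import Mathlib.MeasureTheory.Integral.Prod
import Mathlib.MeasureTheory.Integral.DominatedConvergence
import Mathlib.Analysis.Calculus.ContDiff.Deriv
import Mathlib.Analysis.Calculus.Deriv.Support
import Literature.NumberTheory.LFunctions.ZetaScrewHermitianForms
import Literature.NumberTheory.LFunctions.ZetaScrewSeriesProofs
import Literature.NumberTheory.LFunctions.WeilExplicitProofs
import Literature.NumberTheory.LFunctions.WeilExplicitFormulaProofs
import Literature.NumberTheory.LFunctions.WeilZeroSum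
import Literature.NumberTheory.LFunctions.ZetaZeroReciprocalSum
import Literature.NumberTheory.LFunctions.ZetaZerosReflection
import HarnessLib

/-!
# Suzuki's Prop. 3.1 `⟨Dψ₁, Dψ₂⟩_{G_g,a} = W(ψ₁ ∗ ψ̃₂)` — PROOF (discharge of `Suzuki2023_prop31`)

LINE 1 — LABEL: RH-FREE (every declaration here is a theorem proved in this file or a proof-local
definition; no named fact; nothing about the truth of RH). bears_on: LADDER-RH B-C/B-P (COLUMN 6
DBR) — record only. WHAT THIS IS NOT: not a route and not progress toward RH; Prop. 3.1 is the
RH-free identity that makes Suzuki's criterion Thm. 1.3 a re-indexing of Weil's positivity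
criterion (COLUMN 2); nothing here bears on the truth of RH.

Source: M. Suzuki, *Aspects of the screw function corresponding to the Riemann zeta-function*,
J. Lond. Math. Soc. (2) 108 (2023) 1448–1487 = arXiv:2206.03682 [`Suzuki2023`], §3.1 eq. (3.1) and
§3.3 Prop. 3.1 (held text `paper:arxiv-2206.03682` p0007:L15–50, L119–133). Statement typed in
`ZetaScrewHermitianForms.lean` as `Suzuki2023_prop31`: for `0 < a` and `ψ₁, ψ₂ ∈ C(a)`,
`HasWeilZeroSide (ψ₁ ∗ ψ̃₂) (⟨ψ₁′, ψ₂′⟩_{G_g,(−a,a)})` — the symmetric zero side `Σ_ρ m(ρ) ĝ(ρ)` of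
`g = ψ₁ ∗ ψ̃₂` (Suzuki's `W(g) = Σ_γ ĝ(γ)`, (3.3)) converges to the hermitian form (1.10) of the
derivatives.

## The proof (as printed, with the interchange justified)

1. (1.9) unconditionally: from Thm. 1.1 (2) (`Suzuki2023_thm11_series_holds`, in the variable `ρ`,
   `κ = ρ − 1/2`, `c_ρ(x) = (cosh κx − 1)/κ²`): `G_g(t,u) = Σ_ρ m(ρ)(c_ρ(t) + c_ρ(u) − c_ρ(t−u))`
   (`hasSum_zetaScrewKernel`).
2. Termwise integration over the square `(−a,a)²` against `ψ₁′(u) conj ψ₂′(t)`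
   (`hasSum_term`), by dominated convergence (`hasSum_integral_of_dominated_convergence`) with the
   summable majorant `3(cosh a + 1)‖ψ₁′‖_∞‖ψ₂′‖_∞ · m(ρ)/‖κ_ρ‖²`
   (`norm_cTerm_le`: `|cosh(κx) − 1| ≤ cosh a + 1` for `|Re κ| ≤ 1/2`, `|x| ≤ 2a`;
   `summable_zeroOrder_div_norm_sub_half_sq`: `Σ m(ρ)/‖ρ − 1/2‖² < ∞`, from the tree's
   `Σ m(ρ)/(1+γ²) < ∞` (`ZetaZeroSum.summable_zeroOrder_div_one_add_sq`, Jensen / Titchmarsh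
   Thm. 9.2) and the gap `|γ| ≥ 2δ` (`ZetaZeroSum.exists_gap_im`)).
3. Each term (3.1) (`integral_term`): the pieces `c_ρ(t)`, `c_ρ(u)` and the `−1/κ²` of `c_ρ(t−u)`
   integrate to `0` because `∫ψ′ = 0`; `cosh κ(t−u) = (e^{κt}e^{−κu} + e^{−κt}e^{κu})/2`
   separates variables (`integral_prod_mul`); integration by parts
   `∫ e^{(w−1/2)u} ψ′(u) du = −(w − 1/2) ĝ(w)` (`integral_exp_mul_deriv`) and
   `(ψ₁ ∗ ψ̃₂)^ = ψ̂₁ · ψ̃₂^` (`weilMellin_weilConv_holds`, `weilMellin_weilReflect_holds`) give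
   `∫∫ m(c_ρ(t)+c_ρ(u)−c_ρ(t−u)) ψ₁′(u) conj ψ₂′(t) = (m(ρ)/2)(ĝ(ρ) + ĝ(1−ρ))`.
4. Pairing `ρ ↔ 1 − ρ` (an involution of the zero subtype; multiplicities by `riemannZetaZeroOrder_one_sub_holds`)
   and absolute convergence of `Σ m(ρ)ĝ(ρ)` for the test function `g`
   (`summable_norm_zeroSide`) identify the sum with `Σ' m(ρ)ĝ(ρ)`, which is the symmetric limit
   (`hasWeilZeroSide_tsum`): `Suzuki2023_prop31_holds`.

Deviation from the printed text: none in substance; the source states (3.1) "for integrable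
functions supported in `[−a,a]`" and integrates by parts inside the sum — we integrate the
derivatives first (same computation) and only need (3.1) for `φᵢ = ψᵢ′`.
-/

noncomputable section

open MeasureTheory Set Filter Complex
open scoped ComplexConjugate ComplexOrder Topology ContDiff Real

namespace Literature.NumberTheory.LFunctions

namespace ZetaScrewProp31

/-! ### Elementary bounds -/

/-- `‖cosh w‖ ≤ cosh (Re w)`. [folklore] -/
private theorem norm_cosh_le (w : ℂ) : ‖Complex.cosh w‖ ≤ Real.cosh w.re := by
  rw [Complex.cosh, Real.cosh_eq]
  have h2 : ‖(cexp w + cexp (-w)) / 2‖ = ‖cexp w + cexp (-w)‖ / 2 := by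
    rw [norm_div]; norm_num
  rw [h2]
  gcongr
  calc ‖cexp w + cexp (-w)‖ ≤ ‖cexp w‖ + ‖cexp (-w)‖ := norm_add_le _ _
    _ = Real.exp w.re + Real.exp (-w.re) := by rw [Complex.norm_exp, Complex.norm_exp, neg_re]

/-- For `|Re κ| ≤ 1/2` and `|x| ≤ 2a`: `‖cosh(κx) − 1‖ ≤ cosh a + 1`. [folklore] -/
private theorem norm_cosh_mul_sub_one_le {κ : ℂ} (hκ : |κ.re| ≤ 1 / 2) {x a : ℝ} (hx : |x| ≤ 2 * a) :
    ‖Complex.cosh (κ * x) - 1‖ ≤ Real.cosh a + 1 := by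
  calc ‖Complex.cosh (κ * x) - 1‖ ≤ ‖Complex.cosh (κ * x)‖ + ‖(1 : ℂ)‖ := norm_sub_le _ _
    _ ≤ Real.cosh (κ * x).re + 1 := by rw [norm_one]; linarith [norm_cosh_le (κ * x)]
    _ ≤ Real.cosh a + 1 := by
        suffices h : Real.cosh (κ * x).re ≤ Real.cosh a by linarith
        refine Real.cosh_le_cosh.mpr ?_
        have hre : (κ * x).re = κ.re * x := by simp [mul_re]
        rw [hre, abs_mul]
        have ha : 0 ≤ a := by linarith [abs_nonneg x]
        calc |κ.re| * |x| ≤ (1 / 2) * (2 * a) :=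
              mul_le_mul hκ hx (abs_nonneg _) (by norm_num)
          _ = |a| := by rw [abs_of_nonneg ha]; ring

/-! ### The zero set: `κ_ρ = ρ − 1/2`, summability of `m(ρ)/‖κ_ρ‖²`, the reflection `ρ ↦ 1 − ρ` -/

/-- For a non-trivial zero, `|Re(ρ − 1/2)| ≤ 1/2`. [folklore] -/
private theorem abs_re_sub_half_le (ρ : ZetaZeros.riemannZetaNontrivialZeros) :
    |((ρ : ℂ) - 1 / 2).re| ≤ 1 / 2 := by
  have h0 := ZetaZeros.riemannZetaNontrivialZeros.re_pos ρ.2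
  have h1 := ZetaZeros.riemannZetaNontrivialZeros.re_lt_one ρ.2
  have : ((ρ : ℂ) - 1 / 2).re = (ρ : ℂ).re - 1 / 2 := by simp
  rw [this, abs_le]; constructor <;> linarith

/-- For a non-trivial zero, `ρ − 1/2 ≠ 0` (the zeros are off the real axis). [folklore] -/
private theorem sub_half_ne_zero (ρ : ZetaZeros.riemannZetaNontrivialZeros) : (ρ : ℂ) - 1 / 2 ≠ 0 := by
  intro h
  have him := ZetaZeros.riemannZetaNontrivialZeros.im_ne_zero ρ.2
  have : ((ρ : ℂ) - 1 / 2).im = 0 := by rw [h]; simp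
  simp at this
  exact him this

/-- `(Im ρ)² ≤ ‖ρ − 1/2‖²`. [folklore] -/
private theorem im_sq_le_norm_sub_half_sq (ρ : ℂ) : ρ.im ^ 2 ≤ ‖ρ - 1 / 2‖ ^ 2 := by
  have h := Complex.abs_im_le_norm (ρ - 1 / 2)
  have him : (ρ - 1 / 2).im = ρ.im := by simp
  rw [him] at h
  nlinarith [abs_nonneg ρ.im, sq_abs ρ.im, norm_nonneg (ρ - 1/2)]

/-- **`Σ_ρ m(ρ)/‖ρ − 1/2‖² < ∞`** over the non-trivial zeros (unconditional: from the tree's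
`Σ m(ρ)/(1 + γ²) < ∞`, Jensen/Titchmarsh Thm. 9.2, and the gap `|γ| ≥ 2δ > 0`). [cite: Titchmarsh1986, §9.2, Thm. 9.2] -/
theorem summable_zeroOrder_div_norm_sub_half_sq :
    Summable fun ρ : ZetaZeros.riemannZetaNontrivialZeros ↦
      (riemannZetaZeroOrder (ρ : ℂ) : ℝ) / ‖(ρ : ℂ) - 1 / 2‖ ^ 2 := by
  obtain ⟨δ, hδ, -, hgap⟩ := ZetaZeroSum.exists_gap_im
  have hS := ZetaZeroSum.summable_zeroOrder_div_one_add_sq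
  refine Summable.of_nonneg_of_le (fun ρ ↦ div_nonneg (ZetaZeroSum.zeroOrder_nonneg ρ) (sq_nonneg _))
    (fun ρ ↦ ?_) (hS.mul_left (1 + 1 / (2 * δ) ^ 2))
  have hm : (0 : ℝ) ≤ riemannZetaZeroOrder (ρ : ℂ) := ZetaZeroSum.zeroOrder_nonneg ρ
  have hγ : 2 * δ ≤ |(ρ : ℂ).im| := hgap _ ρ.2
  have hγ2 : (2 * δ) ^ 2 ≤ (ρ : ℂ).im ^ 2 := by
    rw [← sq_abs ((ρ : ℂ).im)]; exact pow_le_pow_left₀ (by positivity) hγ 2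
  have hγpos : 0 < (ρ : ℂ).im ^ 2 := lt_of_lt_of_le (by positivity) hγ2
  have hκ : (ρ : ℂ).im ^ 2 ≤ ‖(ρ : ℂ) - 1 / 2‖ ^ 2 := im_sq_le_norm_sub_half_sq _
  have hκpos : 0 < ‖(ρ : ℂ) - 1 / 2‖ ^ 2 := lt_of_lt_of_le hγpos hκ
  -- `1/‖κ‖² ≤ 1/γ² ≤ (1 + 1/(2δ)²)/(1 + γ²)`
  have key : 1 / ‖(ρ : ℂ) - 1 / 2‖ ^ 2 ≤ (1 + 1 / (2 * δ) ^ 2) / (1 + (ρ : ℂ).im ^ 2) := by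
    rw [div_le_div_iff₀ hκpos (by positivity)]
    have h4 : 0 < (2 * δ) ^ 2 := by positivity
    calc 1 * (1 + (ρ : ℂ).im ^ 2) = 1 + (ρ : ℂ).im ^ 2 := one_mul _
      _ ≤ (ρ : ℂ).im ^ 2 / (2 * δ) ^ 2 + (ρ : ℂ).im ^ 2 := by
          gcongr; rw [le_div_iff₀ h4, one_mul]; exact hγ2
      _ = (1 + 1 / (2 * δ) ^ 2) * (ρ : ℂ).im ^ 2 := by ring
      _ ≤ (1 + 1 / (2 * δ) ^ 2) * ‖(ρ : ℂ) - 1 / 2‖ ^ 2 := by gcongr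
  calc (riemannZetaZeroOrder (ρ : ℂ) : ℝ) / ‖(ρ : ℂ) - 1 / 2‖ ^ 2
      = (riemannZetaZeroOrder (ρ : ℂ) : ℝ) * (1 / ‖(ρ : ℂ) - 1 / 2‖ ^ 2) := by ring
    _ ≤ (riemannZetaZeroOrder (ρ : ℂ) : ℝ) * ((1 + 1 / (2 * δ) ^ 2) / (1 + (ρ : ℂ).im ^ 2)) :=
        mul_le_mul_of_nonneg_left key hm
    _ = (1 + 1 / (2 * δ) ^ 2) * ((riemannZetaZeroOrder (ρ : ℂ) : ℝ) / (1 + (ρ : ℂ).im ^ 2)) := by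
        ring

/-- `1 − ρ` is a non-trivial zero along with `ρ`, with the same multiplicity (functional
equation; `riemannZetaZeroOrder_one_sub_holds`). [cite: Titchmarsh1986, §2.12] -/
theorem one_sub_mem_and_zeroOrder (ρ : ZetaZeros.riemannZetaNontrivialZeros) :
    1 - (ρ : ℂ) ∈ ZetaZeros.riemannZetaNontrivialZeros ∧
      riemannZetaZeroOrder (1 - (ρ : ℂ)) = riemannZetaZeroOrder (ρ : ℂ) := by
  refine ⟨?_, riemannZetaZeroOrder_one_sub_holds (ZetaZeros.riemannZetaNontrivialZeros.re_pos ρ.2)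
    (ZetaZeros.riemannZetaNontrivialZeros.re_lt_one ρ.2)⟩
  have h := ZetaZeros.riemannZetaNontrivialZeros.one_sub_conj_mem
    (ZetaZeros.riemannZetaNontrivialZeros.conj_mem ρ.2)
  simpa using h

/-! ### The kernel series (1.9): `G_g(t,u) = Σ_ρ m(ρ) [c_ρ(t) + c_ρ(u) − c_ρ(t−u)]`,
`c_ρ(x) = (cosh(κx) − 1)/κ²`, `κ = ρ − 1/2` -/

/-- `‖c_ρ(x)‖ ≤ (cosh a + 1)/‖ρ − 1/2‖²` for `|x| ≤ 2a` and `ρ` a non-trivial zero. [folklore] -/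
private theorem norm_cTerm_le (ρ : ZetaZeros.riemannZetaNontrivialZeros) {x a : ℝ} (hx : |x| ≤ 2 * a) :
    ‖((Complex.cosh (((ρ : ℂ) - 1 / 2) * (x : ℂ)) - 1) / ((ρ : ℂ) - 1 / 2) ^ 2)‖ ≤ (Real.cosh a + 1) / ‖(ρ : ℂ) - 1 / 2‖ ^ 2 := by
  rw [norm_div, norm_pow]
  exact div_le_div_of_nonneg_right (norm_cosh_mul_sub_one_le (abs_re_sub_half_le ρ) hx)
    (by positivity)

/-- Thm. 1.1 (2) (`Suzuki2023_thm11_series_holds`) in the `cTerm` notation. [cite: Suzuki2023, Thm 1.1 (2)] -/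
theorem hasSum_zetaScrew (x : ℝ) :
    HasSum (fun ρ : ZetaZeros.riemannZetaNontrivialZeros ↦
      (riemannZetaZeroOrder (ρ : ℂ) : ℂ) * ((Complex.cosh (((ρ : ℂ) - 1 / 2) * (x : ℂ)) - 1) / ((ρ : ℂ) - 1 / 2) ^ 2)) (zetaScrew x : ℂ) :=
  Suzuki2023_thm11_series_holds x

/-- **(1.9)**: the kernel as a series over the zeros, unconditionally:
`G_g(t,u) = Σ_ρ m(ρ) (c_ρ(t) + c_ρ(u) − c_ρ(t − u))`. [cite: Suzuki2023, (1.9)] -/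
theorem hasSum_zetaScrewKernel (t u : ℝ) :
    HasSum (fun ρ : ZetaZeros.riemannZetaNontrivialZeros ↦
      (riemannZetaZeroOrder (ρ : ℂ) : ℂ) * (((Complex.cosh (((ρ : ℂ) - 1 / 2) * (t : ℂ)) - 1) / ((ρ : ℂ) - 1 / 2) ^ 2) + ((Complex.cosh (((ρ : ℂ) - 1 / 2) * (u : ℂ)) - 1) / ((ρ : ℂ) - 1 / 2) ^ 2) - ((Complex.cosh (((ρ : ℂ) - 1 / 2) * ((t - u : ℝ) : ℂ)) - 1) / ((ρ : ℂ) - 1 / 2) ^ 2)))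
      (zetaScrewKernel t u : ℂ) := by
  have h := ((hasSum_zetaScrew t).add (hasSum_zetaScrew u)).sub (hasSum_zetaScrew (t - u))
  rw [zetaScrewKernel]
  push_cast at h ⊢
  refine h.congr_fun fun ρ ↦ ?_
  ring


/-! ### Test functions supported in `[−a, a]`: vanishing, conjugation, integration by parts -/

section TestFunctions

variable {a : ℝ} {ψ : ℝ → ℂ}

/-- A continuous function with `tsupport ⊆ [l, r]` vanishes at `l`. [folklore] -/
private theorem apply_left_eq_zero {f : ℝ → ℂ} {l r : ℝ} (hf : Continuous f)
    (h : tsupport f ⊆ Icc l r) : f l = 0 := by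
  by_contra hne
  obtain ⟨x, hx, hxl⟩ :=
    (((hf.continuousAt.eventually_ne hne).filter_mono nhdsWithin_le_nhds).and
      (self_mem_nhdsWithin (s := Iio l))).exists
  exact absurd (h (subset_tsupport _ hx)).1 (not_le.mpr hxl)

/-- A continuous function with `tsupport ⊆ [l, r]` vanishes at `r`. [folklore] -/
private theorem apply_right_eq_zero {f : ℝ → ℂ} {l r : ℝ} (hf : Continuous f)
    (h : tsupport f ⊆ Icc l r) : f r = 0 := by
  by_contra hne
  obtain ⟨x, hx, hxr⟩ :=
    (((hf.continuousAt.eventually_ne hne).filter_mono nhdsWithin_le_nhds).and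
      (self_mem_nhdsWithin (s := Ioi r))).exists
  exact absurd (h (subset_tsupport _ hx)).2 (not_le.mpr hxr)

/-- A continuous function with `tsupport ⊆ [l, r]` vanishes off `(l, r)`. [folklore] -/
private theorem apply_eq_zero_of_not_mem_Ioo {f : ℝ → ℂ} {l r : ℝ} (hf : Continuous f)
    (h : tsupport f ⊆ Icc l r) {x : ℝ} (hx : x ∉ Ioo l r) : f x = 0 := by
  by_cases hxl : x = l
  · exact hxl ▸ apply_left_eq_zero hf h
  by_cases hxr : x = r
  · exact hxr ▸ apply_right_eq_zero hf h
  refine image_eq_zero_of_notMem_tsupport fun hxs ↦ hx ?_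
  have hI := h hxs
  exact ⟨lt_of_le_of_ne hI.1 (Ne.symm hxl), lt_of_le_of_ne hI.2 hxr⟩

/-- For `ψ ∈ C(a)`, `ψ′` vanishes off `(−a, a)`. [folklore] -/
private theorem deriv_apply_eq_zero (hψ : ψ ∈ screwTestC a) {x : ℝ} (hx : x ∉ Ioo (-a) a) :
    deriv ψ x = 0 :=
  apply_eq_zero_of_not_mem_Ioo (hψ.1.1.continuous_deriv (by simp))
    (tsupport_deriv_subset.trans hψ.2) hx

/-- For `ψ ∈ C(a)`: `∫_{(−a,a)} ψ′ = 0`. [folklore] -/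
private theorem setIntegral_deriv_eq_zero (hψ : ψ ∈ screwTestC a) :
    ∫ u in Ioo (-a) a, deriv ψ u = 0 := by
  have hd := contDiff_infty_iff_deriv.mp hψ.1.1
  rw [setIntegral_eq_integral_of_forall_compl_eq_zero fun x hx ↦ deriv_apply_eq_zero hψ hx]
  exact integral_eq_zero_of_hasDerivAt_of_integrable (fun x ↦ (hd.1 x).hasDerivAt)
    (hd.2.continuous.integrable_of_hasCompactSupport hψ.1.2.deriv)
    (hψ.1.1.continuous.integrable_of_hasCompactSupport hψ.1.2)

/-- **Integration by parts against an exponential** for a test function: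
`∫ e^{(w−1/2)u} ψ′(u) du = −(w − 1/2) ĝ(w)`, `ĝ = weilMellin ψ`. [folklore] -/
private theorem integral_exp_mul_deriv (hψ : IsWeilTest ψ) (w : ℂ) :
    ∫ u : ℝ, cexp ((w - 1 / 2) * u) * deriv ψ u = -(w - 1 / 2) * weilMellin ψ w := by
  set s : ℂ := w - 1 / 2 with hs
  have hd := contDiff_infty_iff_deriv.mp hψ.1
  have hψc : Continuous ψ := hψ.1.continuous
  have hψ'c : Continuous (deriv ψ) := hd.2.continuous
  have hec : Continuous fun u : ℝ ↦ cexp (s * u) := by fun_prop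
  -- derivative of `F(u) = e^{su} ψ(u)`
  have hF : ∀ u : ℝ, HasDerivAt (fun u : ℝ ↦ cexp (s * u) * ψ u)
      (cexp (s * u) * s * ψ u + cexp (s * u) * deriv ψ u) u := by
    intro u
    have h1 : HasDerivAt (fun u : ℝ ↦ s * (u : ℂ)) s u := by
      simpa using ((hasDerivAt_id u).ofReal_comp).const_mul s
    exact (h1.cexp).mul (hd.1 u).hasDerivAt
  have hI1 : Integrable fun u : ℝ ↦ cexp (s * u) * s * ψ u :=
    ((hec.mul continuous_const).mul hψc).integrable_of_hasCompactSupport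
      (hψ.2.mul_left)
  have hI2 : Integrable fun u : ℝ ↦ cexp (s * u) * deriv ψ u :=
    (hec.mul hψ'c).integrable_of_hasCompactSupport hψ.2.deriv.mul_left
  have hI : Integrable fun u : ℝ ↦ cexp (s * u) * ψ u :=
    (hec.mul hψc).integrable_of_hasCompactSupport hψ.2.mul_left
  have h0 := integral_eq_zero_of_hasDerivAt_of_integrable hF (hI1.add hI2) hI
  rw [integral_add hI1 hI2] at h0
  have h3 : ∫ u : ℝ, cexp (s * u) * s * ψ u = s * weilMellin ψ w := by
    rw [weilMellin, ← integral_const_mul]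
    refine integral_congr_ae (Eventually.of_forall fun u ↦ ?_)
    simp only [← hs]
    ring
  rw [h3] at h0
  linear_combination h0

/-- The set-integral form over the window: for `ψ ∈ C(a)`,
`∫_{(−a,a)} e^{(w−1/2)u} ψ′(u) du = −(w − 1/2) ĝ(w)`. [folklore] -/
private theorem setIntegral_exp_mul_deriv (hψ : ψ ∈ screwTestC a) (w : ℂ) :
    ∫ u in Ioo (-a) a, cexp ((w - 1 / 2) * u) * deriv ψ u = -(w - 1 / 2) * weilMellin ψ w := by
  rw [setIntegral_eq_integral_of_forall_compl_eq_zero fun x hx ↦ by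
    rw [deriv_apply_eq_zero hψ hx, mul_zero]]
  exact integral_exp_mul_deriv hψ.1 w

/-- The pointwise conjugate `t ↦ conj ψ(t)` of a test function in `C(a)` is in `C(a)`. [folklore] -/
private theorem conj_mem_screwTestC (hψ : ψ ∈ screwTestC a) :
    (fun t ↦ conj (ψ t)) ∈ screwTestC a := by
  have hsupp : Function.support (fun t ↦ conj (ψ t)) = Function.support ψ := by
    ext t; simp
  refine ⟨⟨Complex.conjCLE.contDiff.comp hψ.1.1, ?_⟩, ?_⟩
  · exact hψ.1.2.comp_left (g := conj) (map_zero _)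
  · rw [tsupport, hsupp]; exact hψ.2

/-- `deriv (conj ∘ ψ) = conj ∘ ψ′` for a differentiable `ψ : ℝ → ℂ`. [folklore] -/
private theorem deriv_conj_comp (hψ : IsWeilTest ψ) :
    deriv (fun t ↦ conj (ψ t)) = fun t ↦ conj (deriv ψ t) := by
  have hd := contDiff_infty_iff_deriv.mp hψ.1
  funext t
  have h := ((hd.1 t).hasDerivAt).star
  simp only [Complex.star_def] at h
  exact h.deriv

/-- `weilMellin (conj ∘ ψ) w = weilMellin (weilReflect ψ) (1 − w)`. [folklore] -/
private theorem weilMellin_conj_comp (ψ : ℝ → ℂ) (w : ℂ) :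
    weilMellin (fun t ↦ conj (ψ t)) w = weilMellin (weilReflect ψ) (1 - w) := by
  rw [weilMellin_weilReflect_holds, weilMellin, weilMellin, ← integral_conj]
  refine integral_congr_ae (Eventually.of_forall fun t ↦ ?_)
  simp only [map_mul, Complex.conj_conj, ← Complex.exp_conj, map_sub, Complex.conj_ofReal,
    map_one]
  congr 2
  have h2 : (starRingEnd ℂ) (1 / 2 : ℂ) = 1 / 2 := by
    rw [map_div₀, map_one, map_ofNat]
  rw [h2]
  ring

end TestFunctions

/-! ### The double integral of one term of the kernel series -/

section Term

variable {a : ℝ} {ψ₁ ψ₂ : ℝ → ℂ}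

/-- `x ↦ c_ρ(x)` is continuous. [folklore] -/
private theorem continuous_cTerm (ρ : ℂ) : Continuous fun x : ℝ ↦ ((Complex.cosh (((ρ : ℂ) - 1 / 2) * (x : ℂ)) - 1) / ((ρ : ℂ) - 1 / 2) ^ 2) := by
  exact ((Complex.continuous_cosh.comp (continuous_const.mul continuous_ofReal)).sub
    continuous_const).div_const _

/-- Continuous functions on `ℝ²` are integrable on the square `(−a,a)²`. [folklore] -/
private theorem integrable_sq_of_continuous {Φ : ℝ × ℝ → ℂ} (hΦ : Continuous Φ) :
    Integrable Φ ((volume.restrict (Ioo (-a) a)).prod (volume.restrict (Ioo (-a) a))) := by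
  rw [Measure.prod_restrict, ← Measure.volume_eq_prod]
  exact (hΦ.continuousOn.integrableOn_compact (isCompact_Icc.prod isCompact_Icc)).mono_set
    (Set.prod_mono Ioo_subset_Icc_self Ioo_subset_Icc_self)

/-- Pointwise decomposition of one term of (1.9) against `F₁ = ψ₁′(u)`, `F₂ = conj ψ₂′(t)` into
separated products (`cosh κ(t−u) = (e^{κt}e^{−κu} + e^{−κt}e^{κu})/2`). [folklore] -/
private theorem term_decomposition (κ F₁ F₂ : ℂ) (t u : ℝ) :
    ((Complex.cosh (κ * t) - 1) / κ ^ 2 + (Complex.cosh (κ * u) - 1) / κ ^ 2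
        - (Complex.cosh (κ * ((t - u : ℝ) : ℂ)) - 1) / κ ^ 2) * F₁ * F₂ =
      (Complex.cosh (κ * t) - 1) / κ ^ 2 * F₂ * F₁
        + F₂ * ((Complex.cosh (κ * u) - 1) / κ ^ 2 * F₁)
        + (κ ^ 2)⁻¹ * (F₂ * F₁)
        - (2 * κ ^ 2)⁻¹ * ((cexp (κ * t) * F₂) * (cexp (-κ * u) * F₁))
        - (2 * κ ^ 2)⁻¹ * ((cexp (-κ * t) * F₂) * (cexp (κ * u) * F₁)) := by
  have hcosh : Complex.cosh (κ * ((t - u : ℝ) : ℂ)) =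
      (cexp (κ * t) * cexp (-κ * u) + cexp (-κ * t) * cexp (κ * u)) / 2 := by
    rw [Complex.cosh, ← Complex.exp_add, ← Complex.exp_add]
    push_cast
    congr 1
    · congr 1 <;> ring_nf
  rw [hcosh]
  ring

/-- **One term of the zero-side series.** For `ψ₁, ψ₂ ∈ C(a)` and a non-trivial zero `ρ`,
`∫∫_{(−a,a)²} m(ρ)(c_ρ(t) + c_ρ(u) − c_ρ(t−u)) ψ₁′(u) conj ψ₂′(t) = (m(ρ)/2)(ĝ(ρ) + ĝ(1−ρ))`,
`g = ψ₁ ∗ ψ̃₂` (integration by parts, (3.1) of the source). [cite: Suzuki2023, §3.1 eq. (3.1) and Prop 3.1 (proof), p. 7] -/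
theorem integral_term (hψ₁ : ψ₁ ∈ screwTestC a) (hψ₂ : ψ₂ ∈ screwTestC a)
    (ρ : ZetaZeros.riemannZetaNontrivialZeros) :
    ∫ z, (riemannZetaZeroOrder (ρ : ℂ) : ℂ) *
        (((Complex.cosh (((ρ : ℂ) - 1 / 2) * (z.1 : ℂ)) - 1) / ((ρ : ℂ) - 1 / 2) ^ 2) + ((Complex.cosh (((ρ : ℂ) - 1 / 2) * (z.2 : ℂ)) - 1) / ((ρ : ℂ) - 1 / 2) ^ 2) - ((Complex.cosh (((ρ : ℂ) - 1 / 2) * ((z.1 - z.2 : ℝ) : ℂ)) - 1) / ((ρ : ℂ) - 1 / 2) ^ 2)) * deriv ψ₁ z.2 * conj (deriv ψ₂ z.1)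
        ∂((volume.restrict (Ioo (-a) a)).prod (volume.restrict (Ioo (-a) a))) =
      (riemannZetaZeroOrder (ρ : ℂ) : ℂ) / 2 *
        (weilMellin (weilConv ψ₁ (weilReflect ψ₂)) ρ +
          weilMellin (weilConv ψ₁ (weilReflect ψ₂)) (1 - (ρ : ℂ))) := by
  have hχ : (fun t ↦ conj (ψ₂ t)) ∈ screwTestC a := conj_mem_screwTestC hψ₂
  have hχ' : (fun t ↦ conj (deriv ψ₂ t)) = deriv (fun t ↦ conj (ψ₂ t)) :=
    (deriv_conj_comp hψ₂.1).symm
  have hκ0 : (ρ : ℂ) - 1 / 2 ≠ 0 := sub_half_ne_zero ρ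
  have hneg : -((ρ : ℂ) - 1 / 2) = (1 - (ρ : ℂ)) - 1 / 2 := by ring
  -- continuity
  have hf₁c : Continuous (deriv ψ₁) := hψ₁.1.1.continuous_deriv (by simp)
  have hf₂c : Continuous (fun t ↦ conj (deriv ψ₂ t)) := by
    rw [hχ']; exact hχ.1.1.continuous_deriv (by simp)
  have hcc : Continuous fun x : ℝ ↦ ((Complex.cosh (((ρ : ℂ) - 1 / 2) * (x : ℂ)) - 1) / ((ρ : ℂ) - 1 / 2) ^ 2) := continuous_cTerm _
  have hexp : ∀ w : ℂ, Continuous fun x : ℝ ↦ cexp (w * x) := fun w ↦ by fun_prop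
  -- the 1-D integrals
  have hA1 : ∫ u in Ioo (-a) a, cexp (((ρ : ℂ) - 1 / 2) * u) * deriv ψ₁ u =
      -((ρ : ℂ) - 1 / 2) * weilMellin ψ₁ ρ := setIntegral_exp_mul_deriv hψ₁ _
  have hA2 : ∫ u in Ioo (-a) a, cexp (-((ρ : ℂ) - 1 / 2) * u) * deriv ψ₁ u =
      ((ρ : ℂ) - 1 / 2) * weilMellin ψ₁ (1 - ρ) := by
    rw [hneg, setIntegral_exp_mul_deriv hψ₁ (1 - ρ)]; ring
  have hB1 : ∫ t in Ioo (-a) a, cexp (((ρ : ℂ) - 1 / 2) * t) * conj (deriv ψ₂ t) =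
      -((ρ : ℂ) - 1 / 2) * weilMellin (weilReflect ψ₂) (1 - ρ) := by
    have h := setIntegral_exp_mul_deriv hχ ρ
    rw [← hχ', weilMellin_conj_comp] at h
    exact h
  have hB2 : ∫ t in Ioo (-a) a, cexp (-((ρ : ℂ) - 1 / 2) * t) * conj (deriv ψ₂ t) =
      ((ρ : ℂ) - 1 / 2) * weilMellin (weilReflect ψ₂) ρ := by
    have h := setIntegral_exp_mul_deriv hχ (1 - ρ)
    rw [← hχ', weilMellin_conj_comp, sub_sub_cancel, ← hneg] at h
    rw [h]; ring
  have hZ1 : ∫ u in Ioo (-a) a, deriv ψ₁ u = 0 := setIntegral_deriv_eq_zero hψ₁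
  have hZ2 : ∫ t in Ioo (-a) a, conj (deriv ψ₂ t) = 0 := by
    have h := setIntegral_deriv_eq_zero hχ
    rw [← hχ'] at h
    exact h
  -- the convolution transform
  have hconv : ∀ w : ℂ, weilMellin (weilConv ψ₁ (weilReflect ψ₂)) w =
      weilMellin ψ₁ w * weilMellin (weilReflect ψ₂) w := fun w ↦
    weilMellin_weilConv_holds hψ₁.1.1.continuous hψ₁.1.2 hψ₂.1.weilReflect.1.continuous
      hψ₂.1.weilReflect.2 w
  -- decompose the integrand
  have hdecomp : ∀ z : ℝ × ℝ, (riemannZetaZeroOrder (ρ : ℂ) : ℂ) *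
      (((Complex.cosh (((ρ : ℂ) - 1 / 2) * (z.1 : ℂ)) - 1) / ((ρ : ℂ) - 1 / 2) ^ 2) + ((Complex.cosh (((ρ : ℂ) - 1 / 2) * (z.2 : ℂ)) - 1) / ((ρ : ℂ) - 1 / 2) ^ 2) - ((Complex.cosh (((ρ : ℂ) - 1 / 2) * ((z.1 - z.2 : ℝ) : ℂ)) - 1) / ((ρ : ℂ) - 1 / 2) ^ 2)) * deriv ψ₁ z.2 * conj (deriv ψ₂ z.1) =
      (riemannZetaZeroOrder (ρ : ℂ) : ℂ) *
        (((Complex.cosh (((ρ : ℂ) - 1 / 2) * (z.1 : ℂ)) - 1) / ((ρ : ℂ) - 1 / 2) ^ 2) * conj (deriv ψ₂ z.1) * deriv ψ₁ z.2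
          + conj (deriv ψ₂ z.1) * (((Complex.cosh (((ρ : ℂ) - 1 / 2) * (z.2 : ℂ)) - 1) / ((ρ : ℂ) - 1 / 2) ^ 2) * deriv ψ₁ z.2)
          + (((ρ : ℂ) - 1 / 2) ^ 2)⁻¹ * (conj (deriv ψ₂ z.1) * deriv ψ₁ z.2)
          - (2 * ((ρ : ℂ) - 1 / 2) ^ 2)⁻¹ *
              ((cexp (((ρ : ℂ) - 1 / 2) * z.1) * conj (deriv ψ₂ z.1)) *
                (cexp (-((ρ : ℂ) - 1 / 2) * z.2) * deriv ψ₁ z.2))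
          - (2 * ((ρ : ℂ) - 1 / 2) ^ 2)⁻¹ *
              ((cexp (-((ρ : ℂ) - 1 / 2) * z.1) * conj (deriv ψ₂ z.1)) *
                (cexp (((ρ : ℂ) - 1 / 2) * z.2) * deriv ψ₁ z.2))) := by
    intro z
    have h := term_decomposition ((ρ : ℂ) - 1 / 2) (deriv ψ₁ z.2) (conj (deriv ψ₂ z.1)) z.1 z.2
    rw [mul_assoc, mul_assoc, ← mul_assoc (_ + _ - _), h]
  rw [integral_congr_ae (Eventually.of_forall hdecomp), integral_const_mul]
  -- integrability of the five pieces
  have hI1 : Integrable (fun z : ℝ × ℝ ↦ ((Complex.cosh (((ρ : ℂ) - 1 / 2) * (z.1 : ℂ)) - 1) / ((ρ : ℂ) - 1 / 2) ^ 2) * conj (deriv ψ₂ z.1) * deriv ψ₁ z.2)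
      ((volume.restrict (Ioo (-a) a)).prod (volume.restrict (Ioo (-a) a))) :=
    integrable_sq_of_continuous
      (((hcc.comp continuous_fst).mul (hf₂c.comp continuous_fst)).mul (hf₁c.comp continuous_snd))
  have hI2 : Integrable (fun z : ℝ × ℝ ↦ conj (deriv ψ₂ z.1) * (((Complex.cosh (((ρ : ℂ) - 1 / 2) * (z.2 : ℂ)) - 1) / ((ρ : ℂ) - 1 / 2) ^ 2) * deriv ψ₁ z.2))
      ((volume.restrict (Ioo (-a) a)).prod (volume.restrict (Ioo (-a) a))) :=
    integrable_sq_of_continuous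
      ((hf₂c.comp continuous_fst).mul ((hcc.comp continuous_snd).mul (hf₁c.comp continuous_snd)))
  have hI3 : Integrable (fun z : ℝ × ℝ ↦
      (((ρ : ℂ) - 1 / 2) ^ 2)⁻¹ * (conj (deriv ψ₂ z.1) * deriv ψ₁ z.2))
      ((volume.restrict (Ioo (-a) a)).prod (volume.restrict (Ioo (-a) a))) :=
    integrable_sq_of_continuous
      (continuous_const.mul ((hf₂c.comp continuous_fst).mul (hf₁c.comp continuous_snd)))
  have hI4 : Integrable (fun z : ℝ × ℝ ↦ (2 * ((ρ : ℂ) - 1 / 2) ^ 2)⁻¹ *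
      ((cexp (((ρ : ℂ) - 1 / 2) * z.1) * conj (deriv ψ₂ z.1)) *
        (cexp (-((ρ : ℂ) - 1 / 2) * z.2) * deriv ψ₁ z.2)))
      ((volume.restrict (Ioo (-a) a)).prod (volume.restrict (Ioo (-a) a))) :=
    integrable_sq_of_continuous
      (continuous_const.mul ((((hexp _).comp continuous_fst).mul (hf₂c.comp continuous_fst)).mul
        (((hexp _).comp continuous_snd).mul (hf₁c.comp continuous_snd))))
  have hI5 : Integrable (fun z : ℝ × ℝ ↦ (2 * ((ρ : ℂ) - 1 / 2) ^ 2)⁻¹ *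
      ((cexp (-((ρ : ℂ) - 1 / 2) * z.1) * conj (deriv ψ₂ z.1)) *
        (cexp (((ρ : ℂ) - 1 / 2) * z.2) * deriv ψ₁ z.2)))
      ((volume.restrict (Ioo (-a) a)).prod (volume.restrict (Ioo (-a) a))) :=
    integrable_sq_of_continuous
      (continuous_const.mul ((((hexp _).comp continuous_fst).mul (hf₂c.comp continuous_fst)).mul
        (((hexp _).comp continuous_snd).mul (hf₁c.comp continuous_snd))))
  have hI12 : Integrable (fun z : ℝ × ℝ ↦ ((Complex.cosh (((ρ : ℂ) - 1 / 2) * (z.1 : ℂ)) - 1) / ((ρ : ℂ) - 1 / 2) ^ 2) * conj (deriv ψ₂ z.1) * deriv ψ₁ z.2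
      + conj (deriv ψ₂ z.1) * (((Complex.cosh (((ρ : ℂ) - 1 / 2) * (z.2 : ℂ)) - 1) / ((ρ : ℂ) - 1 / 2) ^ 2) * deriv ψ₁ z.2))
      ((volume.restrict (Ioo (-a) a)).prod (volume.restrict (Ioo (-a) a))) := hI1.add hI2
  have hI123 : Integrable (fun z : ℝ × ℝ ↦ ((Complex.cosh (((ρ : ℂ) - 1 / 2) * (z.1 : ℂ)) - 1) / ((ρ : ℂ) - 1 / 2) ^ 2) * conj (deriv ψ₂ z.1) * deriv ψ₁ z.2
      + conj (deriv ψ₂ z.1) * (((Complex.cosh (((ρ : ℂ) - 1 / 2) * (z.2 : ℂ)) - 1) / ((ρ : ℂ) - 1 / 2) ^ 2) * deriv ψ₁ z.2)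
      + (((ρ : ℂ) - 1 / 2) ^ 2)⁻¹ * (conj (deriv ψ₂ z.1) * deriv ψ₁ z.2))
      ((volume.restrict (Ioo (-a) a)).prod (volume.restrict (Ioo (-a) a))) := hI12.add hI3
  have hI1234 : Integrable (fun z : ℝ × ℝ ↦ ((Complex.cosh (((ρ : ℂ) - 1 / 2) * (z.1 : ℂ)) - 1) / ((ρ : ℂ) - 1 / 2) ^ 2) * conj (deriv ψ₂ z.1) * deriv ψ₁ z.2
      + conj (deriv ψ₂ z.1) * (((Complex.cosh (((ρ : ℂ) - 1 / 2) * (z.2 : ℂ)) - 1) / ((ρ : ℂ) - 1 / 2) ^ 2) * deriv ψ₁ z.2)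
      + (((ρ : ℂ) - 1 / 2) ^ 2)⁻¹ * (conj (deriv ψ₂ z.1) * deriv ψ₁ z.2)
      - (2 * ((ρ : ℂ) - 1 / 2) ^ 2)⁻¹ *
          ((cexp (((ρ : ℂ) - 1 / 2) * z.1) * conj (deriv ψ₂ z.1)) *
            (cexp (-((ρ : ℂ) - 1 / 2) * z.2) * deriv ψ₁ z.2)))
      ((volume.restrict (Ioo (-a) a)).prod (volume.restrict (Ioo (-a) a))) := hI123.sub hI4
  rw [integral_sub hI1234 hI5, integral_sub hI123 hI4, integral_add hI12 hI3, integral_add hI1 hI2]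
  -- evaluate each piece as a product of 1-D integrals
  rw [integral_prod_mul (fun t : ℝ ↦ ((Complex.cosh (((ρ : ℂ) - 1 / 2) * (t : ℂ)) - 1) / ((ρ : ℂ) - 1 / 2) ^ 2) * conj (deriv ψ₂ t)) (deriv ψ₁),
    integral_prod_mul (fun t : ℝ ↦ conj (deriv ψ₂ t)) (fun u : ℝ ↦ ((Complex.cosh (((ρ : ℂ) - 1 / 2) * (u : ℂ)) - 1) / ((ρ : ℂ) - 1 / 2) ^ 2) * deriv ψ₁ u),
    integral_const_mul (((ρ : ℂ) - 1 / 2) ^ 2)⁻¹,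
    integral_prod_mul (fun t ↦ conj (deriv ψ₂ t)) (deriv ψ₁),
    integral_const_mul (2 * ((ρ : ℂ) - 1 / 2) ^ 2)⁻¹,
    integral_prod_mul (fun t : ℝ ↦ cexp (((ρ : ℂ) - 1 / 2) * t) * conj (deriv ψ₂ t))
      (fun u : ℝ ↦ cexp (-((ρ : ℂ) - 1 / 2) * u) * deriv ψ₁ u),
    integral_const_mul (2 * ((ρ : ℂ) - 1 / 2) ^ 2)⁻¹,
    integral_prod_mul (fun t : ℝ ↦ cexp (-((ρ : ℂ) - 1 / 2) * t) * conj (deriv ψ₂ t))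
      (fun u : ℝ ↦ cexp (((ρ : ℂ) - 1 / 2) * u) * deriv ψ₁ u)]
  rw [hZ1, hZ2, hA1, hA2, hB1, hB2, hconv ρ, hconv (1 - ρ)]
  have hk : ((ρ : ℂ) - 1 / 2) ^ 2 * (((ρ : ℂ) - 1 / 2) ^ 2)⁻¹ = 1 :=
    mul_inv_cancel₀ (pow_ne_zero 2 hκ0)
  simp only [mul_inv]
  linear_combination ((riemannZetaZeroOrder (ρ : ℂ) : ℂ) / 2 *
    (weilMellin (weilReflect ψ₂) (1 - ρ) * weilMellin ψ₁ (1 - ρ) +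
      weilMellin (weilReflect ψ₂) ρ * weilMellin ψ₁ ρ)) * hk

end Term

/-! ### Assembly: (3.1) summed over the zeros, and Prop. 3.1 -/

section Assembly

variable {a : ℝ} {ψ₁ ψ₂ : ℝ → ℂ}

/-- The kernel `G_g` is jointly continuous (`Ψ` is continuous, `continuous_zetaScrew`). [folklore] -/
private theorem continuous_zetaScrewKernel_uncurry :
    Continuous fun z : ℝ × ℝ ↦ zetaScrewKernel z.1 z.2 := by
  unfold zetaScrewKernel
  exact ((continuous_zetaScrew.comp continuous_fst).add
    (continuous_zetaScrew.comp continuous_snd)).sub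
      (continuous_zetaScrew.comp (continuous_fst.sub continuous_snd))

/-- The form (1.10) on `ψ₁′, ψ₂′` as an integral over the square `(−a,a)²` (Fubini). [folklore] -/
private theorem zetaScrewForm_deriv_eq_integral_prod (hψ₁ : ψ₁ ∈ screwTestC a) (hψ₂ : ψ₂ ∈ screwTestC a) :
    zetaScrewForm (Ioo (-a) a) (deriv ψ₁) (deriv ψ₂) =
      ∫ z, (zetaScrewKernel z.1 z.2 : ℂ) * deriv ψ₁ z.2 * conj (deriv ψ₂ z.1)
        ∂((volume.restrict (Ioo (-a) a)).prod (volume.restrict (Ioo (-a) a))) := by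
  have hf₁c : Continuous (deriv ψ₁) := hψ₁.1.1.continuous_deriv (by simp)
  have hf₂c : Continuous (fun t ↦ conj (deriv ψ₂ t)) :=
    Complex.continuous_conj.comp (hψ₂.1.1.continuous_deriv (by simp))
  have hint : Integrable (fun z : ℝ × ℝ ↦
      (zetaScrewKernel z.1 z.2 : ℂ) * deriv ψ₁ z.2 * conj (deriv ψ₂ z.1))
      ((volume.restrict (Ioo (-a) a)).prod (volume.restrict (Ioo (-a) a))) :=
    integrable_sq_of_continuous
      (((continuous_ofReal.comp continuous_zetaScrewKernel_uncurry).mul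
        (hf₁c.comp continuous_snd)).mul (hf₂c.comp continuous_fst))
  rw [integral_prod _ hint]
  rfl

/-- **(3.1), summed.** For `ψ₁, ψ₂ ∈ C(a)` the series `Σ_ρ (m(ρ)/2)(ĝ(ρ) + ĝ(1−ρ))`,
`g = ψ₁ ∗ ψ̃₂`, converges to `⟨ψ₁′, ψ₂′⟩_{G_g,a}` (termwise integration of (1.9), justified by
dominated convergence with `Σ m(ρ)/‖ρ − 1/2‖² < ∞`). [cite: Suzuki2023, §3.1 eq. (3.1), p. 7] -/
theorem hasSum_term (ha : 0 < a) (hψ₁ : ψ₁ ∈ screwTestC a) (hψ₂ : ψ₂ ∈ screwTestC a) :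
    HasSum (fun ρ : ZetaZeros.riemannZetaNontrivialZeros ↦
      (riemannZetaZeroOrder (ρ : ℂ) : ℂ) / 2 *
        (weilMellin (weilConv ψ₁ (weilReflect ψ₂)) ρ +
          weilMellin (weilConv ψ₁ (weilReflect ψ₂)) (1 - (ρ : ℂ))))
      (zetaScrewForm (Ioo (-a) a) (deriv ψ₁) (deriv ψ₂)) := by
  haveI : Countable ZetaZeros.riemannZetaNontrivialZeros :=
    riemannZetaNontrivialZeros_countable.to_subtype
  have hf₁c : Continuous (deriv ψ₁) := hψ₁.1.1.continuous_deriv (by simp)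
  have hf₂c' : Continuous (deriv ψ₂) := hψ₂.1.1.continuous_deriv (by simp)
  have hf₂c : Continuous (fun t ↦ conj (deriv ψ₂ t)) := Complex.continuous_conj.comp hf₂c'
  obtain ⟨B₁, hB₁⟩ := hf₁c.bounded_above_of_compact_support hψ₁.1.2.deriv
  obtain ⟨B₂, hB₂⟩ := hf₂c'.bounded_above_of_compact_support hψ₂.1.2.deriv
  have hB₁0 : 0 ≤ B₁ := (norm_nonneg _).trans (hB₁ 0)
  have hB₂0 : 0 ≤ B₂ := (norm_nonneg _).trans (hB₂ 0)
  set C : ℝ := Real.cosh a + 1 with hC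
  have hC0 : 0 ≤ C := by positivity
  rw [zetaScrewForm_deriv_eq_integral_prod hψ₁ hψ₂]
  have hmem : ∀ᵐ z ∂((volume.restrict (Ioo (-a) a)).prod (volume.restrict (Ioo (-a) a))),
      z ∈ Ioo (-a) a ×ˢ Ioo (-a) a := by
    rw [Measure.prod_restrict]
    exact ae_restrict_mem (measurableSet_Ioo.prod measurableSet_Ioo)
  -- the five hypotheses of dominated convergence
  have hF_meas : ∀ ρ : ZetaZeros.riemannZetaNontrivialZeros, AEStronglyMeasurable
      (fun z : ℝ × ℝ ↦ (riemannZetaZeroOrder (ρ : ℂ) : ℂ) *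
        (((Complex.cosh (((ρ : ℂ) - 1 / 2) * (z.1 : ℂ)) - 1) / ((ρ : ℂ) - 1 / 2) ^ 2) + ((Complex.cosh (((ρ : ℂ) - 1 / 2) * (z.2 : ℂ)) - 1) / ((ρ : ℂ) - 1 / 2) ^ 2) - ((Complex.cosh (((ρ : ℂ) - 1 / 2) * ((z.1 - z.2 : ℝ) : ℂ)) - 1) / ((ρ : ℂ) - 1 / 2) ^ 2)) * deriv ψ₁ z.2 * conj (deriv ψ₂ z.1))
      ((volume.restrict (Ioo (-a) a)).prod (volume.restrict (Ioo (-a) a))) := by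
    intro ρ
    have hc : Continuous fun z : ℝ × ℝ ↦ ((Complex.cosh (((ρ : ℂ) - 1 / 2) * (z.1 : ℂ)) - 1) / ((ρ : ℂ) - 1 / 2) ^ 2) + ((Complex.cosh (((ρ : ℂ) - 1 / 2) * (z.2 : ℂ)) - 1) / ((ρ : ℂ) - 1 / 2) ^ 2) - ((Complex.cosh (((ρ : ℂ) - 1 / 2) * ((z.1 - z.2 : ℝ) : ℂ)) - 1) / ((ρ : ℂ) - 1 / 2) ^ 2) :=
      (((continuous_cTerm _).comp continuous_fst).add ((continuous_cTerm _).comp continuous_snd)).sub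
        ((continuous_cTerm _).comp (continuous_fst.sub continuous_snd))
    exact (((continuous_const.mul hc).mul (hf₁c.comp continuous_snd)).mul
      (hf₂c.comp continuous_fst)).aestronglyMeasurable
  have h_bound : ∀ ρ : ZetaZeros.riemannZetaNontrivialZeros,
      ∀ᵐ z ∂((volume.restrict (Ioo (-a) a)).prod (volume.restrict (Ioo (-a) a))),
        ‖(riemannZetaZeroOrder (ρ : ℂ) : ℂ) *
          (((Complex.cosh (((ρ : ℂ) - 1 / 2) * (z.1 : ℂ)) - 1) / ((ρ : ℂ) - 1 / 2) ^ 2) + ((Complex.cosh (((ρ : ℂ) - 1 / 2) * (z.2 : ℂ)) - 1) / ((ρ : ℂ) - 1 / 2) ^ 2) - ((Complex.cosh (((ρ : ℂ) - 1 / 2) * ((z.1 - z.2 : ℝ) : ℂ)) - 1) / ((ρ : ℂ) - 1 / 2) ^ 2)) * deriv ψ₁ z.2 * conj (deriv ψ₂ z.1)‖ ≤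
        3 * C * B₁ * B₂ * ((riemannZetaZeroOrder (ρ : ℂ) : ℝ) / ‖(ρ : ℂ) - 1 / 2‖ ^ 2) := by
    intro ρ
    refine hmem.mono fun z hz ↦ ?_
    have h1l : -a < z.1 := hz.1.1
    have h1r : z.1 < a := hz.1.2
    have h2l : -a < z.2 := hz.2.1
    have h2r : z.2 < a := hz.2.2
    have ht := abs_le.mpr (And.intro (by linarith : -(2 * a) ≤ z.1) (by linarith : z.1 ≤ 2 * a))
    have hu := abs_le.mpr (And.intro (by linarith : -(2 * a) ≤ z.2) (by linarith : z.2 ≤ 2 * a))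
    have htu := abs_le.mpr
      (And.intro (by linarith : -(2 * a) ≤ z.1 - z.2) (by linarith : z.1 - z.2 ≤ 2 * a))
    have hm : (0 : ℝ) ≤ riemannZetaZeroOrder (ρ : ℂ) := ZetaZeroSum.zeroOrder_nonneg ρ
    have hmn : ‖(riemannZetaZeroOrder (ρ : ℂ) : ℂ)‖ = (riemannZetaZeroOrder (ρ : ℂ) : ℝ) := by
      rw [Complex.norm_intCast, abs_of_nonneg hm]
    have hc3 : ‖((Complex.cosh (((ρ : ℂ) - 1 / 2) * (z.1 : ℂ)) - 1) / ((ρ : ℂ) - 1 / 2) ^ 2) + ((Complex.cosh (((ρ : ℂ) - 1 / 2) * (z.2 : ℂ)) - 1) / ((ρ : ℂ) - 1 / 2) ^ 2) - ((Complex.cosh (((ρ : ℂ) - 1 / 2) * ((z.1 - z.2 : ℝ) : ℂ)) - 1) / ((ρ : ℂ) - 1 / 2) ^ 2)‖ ≤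
        3 * (C / ‖(ρ : ℂ) - 1 / 2‖ ^ 2) := by
      have e1 := norm_cTerm_le ρ ht
      have e2 := norm_cTerm_le ρ hu
      have e3 := norm_cTerm_le ρ htu
      calc ‖((Complex.cosh (((ρ : ℂ) - 1 / 2) * (z.1 : ℂ)) - 1) / ((ρ : ℂ) - 1 / 2) ^ 2) + ((Complex.cosh (((ρ : ℂ) - 1 / 2) * (z.2 : ℂ)) - 1) / ((ρ : ℂ) - 1 / 2) ^ 2) - ((Complex.cosh (((ρ : ℂ) - 1 / 2) * ((z.1 - z.2 : ℝ) : ℂ)) - 1) / ((ρ : ℂ) - 1 / 2) ^ 2)‖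
          ≤ ‖((Complex.cosh (((ρ : ℂ) - 1 / 2) * (z.1 : ℂ)) - 1) / ((ρ : ℂ) - 1 / 2) ^ 2) + ((Complex.cosh (((ρ : ℂ) - 1 / 2) * (z.2 : ℂ)) - 1) / ((ρ : ℂ) - 1 / 2) ^ 2)‖ + ‖((Complex.cosh (((ρ : ℂ) - 1 / 2) * ((z.1 - z.2 : ℝ) : ℂ)) - 1) / ((ρ : ℂ) - 1 / 2) ^ 2)‖ := norm_sub_le _ _
        _ ≤ (‖((Complex.cosh (((ρ : ℂ) - 1 / 2) * (z.1 : ℂ)) - 1) / ((ρ : ℂ) - 1 / 2) ^ 2)‖ + ‖((Complex.cosh (((ρ : ℂ) - 1 / 2) * (z.2 : ℂ)) - 1) / ((ρ : ℂ) - 1 / 2) ^ 2)‖) + ‖((Complex.cosh (((ρ : ℂ) - 1 / 2) * ((z.1 - z.2 : ℝ) : ℂ)) - 1) / ((ρ : ℂ) - 1 / 2) ^ 2)‖ := by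
            gcongr; exact norm_add_le _ _
        _ ≤ (C / ‖(ρ : ℂ) - 1 / 2‖ ^ 2 + C / ‖(ρ : ℂ) - 1 / 2‖ ^ 2) + C / ‖(ρ : ℂ) - 1 / 2‖ ^ 2 := by
            gcongr
        _ = 3 * (C / ‖(ρ : ℂ) - 1 / 2‖ ^ 2) := by ring
    calc ‖(riemannZetaZeroOrder (ρ : ℂ) : ℂ) *
          (((Complex.cosh (((ρ : ℂ) - 1 / 2) * (z.1 : ℂ)) - 1) / ((ρ : ℂ) - 1 / 2) ^ 2) + ((Complex.cosh (((ρ : ℂ) - 1 / 2) * (z.2 : ℂ)) - 1) / ((ρ : ℂ) - 1 / 2) ^ 2) - ((Complex.cosh (((ρ : ℂ) - 1 / 2) * ((z.1 - z.2 : ℝ) : ℂ)) - 1) / ((ρ : ℂ) - 1 / 2) ^ 2)) * deriv ψ₁ z.2 * conj (deriv ψ₂ z.1)‖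
        = (riemannZetaZeroOrder (ρ : ℂ) : ℝ) * ‖((Complex.cosh (((ρ : ℂ) - 1 / 2) * (z.1 : ℂ)) - 1) / ((ρ : ℂ) - 1 / 2) ^ 2) + ((Complex.cosh (((ρ : ℂ) - 1 / 2) * (z.2 : ℂ)) - 1) / ((ρ : ℂ) - 1 / 2) ^ 2) - ((Complex.cosh (((ρ : ℂ) - 1 / 2) * ((z.1 - z.2 : ℝ) : ℂ)) - 1) / ((ρ : ℂ) - 1 / 2) ^ 2)‖ *
            ‖deriv ψ₁ z.2‖ * ‖deriv ψ₂ z.1‖ := by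
          rw [norm_mul, norm_mul, norm_mul, hmn, Complex.norm_conj]
      _ ≤ (riemannZetaZeroOrder (ρ : ℂ) : ℝ) * (3 * (C / ‖(ρ : ℂ) - 1 / 2‖ ^ 2)) * B₁ * B₂ := by
          gcongr
          · exact hB₁ _
          · exact hB₂ _
      _ = 3 * C * B₁ * B₂ * ((riemannZetaZeroOrder (ρ : ℂ) : ℝ) / ‖(ρ : ℂ) - 1 / 2‖ ^ 2) := by ring
  have bound_summable : ∀ᵐ z ∂((volume.restrict (Ioo (-a) a)).prod (volume.restrict (Ioo (-a) a))),
      Summable fun ρ : ZetaZeros.riemannZetaNontrivialZeros ↦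
        3 * C * B₁ * B₂ * ((riemannZetaZeroOrder (ρ : ℂ) : ℝ) / ‖(ρ : ℂ) - 1 / 2‖ ^ 2) :=
    Eventually.of_forall fun z ↦ summable_zeroOrder_div_norm_sub_half_sq.mul_left _
  have bound_integrable : Integrable (fun z : ℝ × ℝ ↦
      ∑' ρ : ZetaZeros.riemannZetaNontrivialZeros,
        3 * C * B₁ * B₂ * ((riemannZetaZeroOrder (ρ : ℂ) : ℝ) / ‖(ρ : ℂ) - 1 / 2‖ ^ 2))
      ((volume.restrict (Ioo (-a) a)).prod (volume.restrict (Ioo (-a) a))) :=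
    integrable_const _
  have h_lim : ∀ᵐ z ∂((volume.restrict (Ioo (-a) a)).prod (volume.restrict (Ioo (-a) a))),
      HasSum (fun ρ : ZetaZeros.riemannZetaNontrivialZeros ↦ (riemannZetaZeroOrder (ρ : ℂ) : ℂ) *
        (((Complex.cosh (((ρ : ℂ) - 1 / 2) * (z.1 : ℂ)) - 1) / ((ρ : ℂ) - 1 / 2) ^ 2) + ((Complex.cosh (((ρ : ℂ) - 1 / 2) * (z.2 : ℂ)) - 1) / ((ρ : ℂ) - 1 / 2) ^ 2) - ((Complex.cosh (((ρ : ℂ) - 1 / 2) * ((z.1 - z.2 : ℝ) : ℂ)) - 1) / ((ρ : ℂ) - 1 / 2) ^ 2)) * deriv ψ₁ z.2 * conj (deriv ψ₂ z.1))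
        ((zetaScrewKernel z.1 z.2 : ℂ) * deriv ψ₁ z.2 * conj (deriv ψ₂ z.1)) :=
    Eventually.of_forall fun z ↦
      ((hasSum_zetaScrewKernel z.1 z.2).mul_right (deriv ψ₁ z.2)).mul_right (conj (deriv ψ₂ z.1))
  have h := hasSum_integral_of_dominated_convergence _ hF_meas h_bound bound_summable
    bound_integrable h_lim
  have hF : (fun ρ : ZetaZeros.riemannZetaNontrivialZeros ↦
      ∫ z, (riemannZetaZeroOrder (ρ : ℂ) : ℂ) *
        (((Complex.cosh (((ρ : ℂ) - 1 / 2) * (z.1 : ℂ)) - 1) / ((ρ : ℂ) - 1 / 2) ^ 2) + ((Complex.cosh (((ρ : ℂ) - 1 / 2) * (z.2 : ℂ)) - 1) / ((ρ : ℂ) - 1 / 2) ^ 2) - ((Complex.cosh (((ρ : ℂ) - 1 / 2) * ((z.1 - z.2 : ℝ) : ℂ)) - 1) / ((ρ : ℂ) - 1 / 2) ^ 2)) * deriv ψ₁ z.2 * conj (deriv ψ₂ z.1)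
        ∂((volume.restrict (Ioo (-a) a)).prod (volume.restrict (Ioo (-a) a)))) =
      fun ρ : ZetaZeros.riemannZetaNontrivialZeros ↦ (riemannZetaZeroOrder (ρ : ℂ) : ℂ) / 2 *
        (weilMellin (weilConv ψ₁ (weilReflect ψ₂)) ρ +
          weilMellin (weilConv ψ₁ (weilReflect ψ₂)) (1 - (ρ : ℂ))) :=
    funext fun ρ ↦ integral_term hψ₁ hψ₂ ρ
  rw [hF] at h
  exact h

end Assembly

end ZetaScrewProp31

open ZetaScrewProp31 in
/-- **DISCHARGE of `Suzuki2023_prop31` (Suzuki2023 Prop. 3.1):** for `0 < a` and `ψ₁, ψ₂ ∈ C(a)`,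
the symmetric zero side `Σ_ρ m(ρ) ĝ(ρ)` of `g = ψ₁ ∗ ψ̃₂` converges to `⟨ψ₁′, ψ₂′⟩_{G_g,a}` —
i.e. `⟨Dψ₁, Dψ₂⟩_{G_g,a} = W(ψ₁ ∗ ψ̃₂)`. Proof as printed ((3.1) by termwise integration of the
series (1.9) = Thm. 1.1 (2) `Suzuki2023_thm11_series_holds`, then integration by parts), with the
termwise integration justified by dominated convergence (`Σ m(ρ)/‖ρ−1/2‖² < ∞`), the pairing
`ρ ↔ 1 − ρ` (`riemannZetaZeroOrder_one_sub_holds`) turning `Σ (m/2)(ĝ(ρ) + ĝ(1−ρ))` into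
`Σ m ĝ(ρ)`, and absolute convergence of the latter (`summable_norm_zeroSide`) identifying it with
the symmetric limit (`hasWeilZeroSide_tsum`). [cite: Suzuki2023, Prop 3.1, p. 7 (held text p0007:L119–133)] -/
theorem Suzuki2023_prop31_holds : Suzuki2023_prop31 := by
  intro a ha ψ₁ hψ₁ ψ₂ hψ₂
  have hg : IsWeilTest (weilConv ψ₁ (weilReflect ψ₂)) := hψ₁.1.weilConv hψ₂.1.weilReflect
  have hsum := summable_norm_zeroSide hg
  have hZ := hasWeilZeroSide_tsum hsum
  have hA := hsum.of_norm.hasSum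
  -- the reflection `ρ ↦ 1 − ρ` as a permutation of the zero subtype
  let r : ZetaZeros.riemannZetaNontrivialZeros → ZetaZeros.riemannZetaNontrivialZeros :=
    fun ρ ↦ ⟨1 - (ρ : ℂ), (one_sub_mem_and_zeroOrder ρ).1⟩
  have hr : Function.Involutive r := fun ρ ↦ Subtype.ext (by simp [r])
  have hA' := (Equiv.hasSum_iff (hr.toPerm r)).mpr hA
  have hB : HasSum (fun ρ : ZetaZeros.riemannZetaNontrivialZeros ↦
      (riemannZetaZeroOrder (ρ : ℂ) : ℂ) / 2 *
        (weilMellin (weilConv ψ₁ (weilReflect ψ₂)) ρ +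
          weilMellin (weilConv ψ₁ (weilReflect ψ₂)) (1 - (ρ : ℂ))))
      (∑' ρ : ZetaZeros.riemannZetaNontrivialZeros,
        (riemannZetaZeroOrder (ρ : ℂ) : ℂ) * weilMellin (weilConv ψ₁ (weilReflect ψ₂)) ρ) := by
    have h2 := (hA.add hA').mul_left (1 / 2 : ℂ)
    have e : (1 / 2 : ℂ) * ((∑' ρ : ZetaZeros.riemannZetaNontrivialZeros,
        (riemannZetaZeroOrder (ρ : ℂ) : ℂ) * weilMellin (weilConv ψ₁ (weilReflect ψ₂)) ρ) +
        ∑' ρ : ZetaZeros.riemannZetaNontrivialZeros,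
          (riemannZetaZeroOrder (ρ : ℂ) : ℂ) * weilMellin (weilConv ψ₁ (weilReflect ψ₂)) ρ) =
        ∑' ρ : ZetaZeros.riemannZetaNontrivialZeros,
          (riemannZetaZeroOrder (ρ : ℂ) : ℂ) * weilMellin (weilConv ψ₁ (weilReflect ψ₂)) ρ := by
      ring
    rw [e] at h2
    refine h2.congr_fun fun ρ ↦ ?_
    simp only [Function.comp_apply, Function.Involutive.coe_toPerm, r]
    rw [(one_sub_mem_and_zeroOrder ρ).2]
    ring
  rw [(hasSum_term ha hψ₁ hψ₂).unique hB]
  exact hZ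

end Literature.NumberTheory.LFunctions

end
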